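import Literature.MathematicalPhysics.QuantumManyBody.PeriodicBoseGasLemma33
import Literature.MathematicalPhysics.QuantumManyBody.PeriodicBoseGasKineticMultiplierProofs
import Mathlib.Algebra.Module.ZLattice.Basic
import Mathlib.MeasureTheory.Group.FundamentalDomain
import Mathlib.MeasureTheory.Function.L2Space
import Mathlib.Analysis.InnerProductSpace.Orthonormal
import Mathlib.Analysis.SpecialFunctions.Trigonometric.Bounds
import HarnessLib

/-!
# Route `BECPhaseQuadratureSumRule`, glue `SumRuleChainGlue` (stmt-AtomisticToContinuum-12627) —
# helper: Fourier analysis of the sliding box on the cell (Bessel, tiling, the box average of a plane wave)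

The static-structure input `Σ_{0<|k|<Λ√(ρa)} ‖ρ_k†Ψ‖² ≤ C ε N²` of the chain is read off the crux
`LongWaveStructureBound` (second moments of the particle number in periodised sliding boxes `Λ_ℓ(u)`,
averaged over `u ∈ cell`) by Bessel's inequality in the variable `u`. This file supplies the one-body
Fourier facts on the cell `[0,L)³` with its plane waves `e_p(u) = e^{2πi p·u/L}`:

* `bessel_cell` — **Bessel's inequality** for a bounded measurable `g` on the cell and any finite set of modes:
  `Σ_{p∈S} |∫_cell conj(e_p) g|² ≤ L³ ∫_cell |g|²` (Mathlib's `Orthonormal.sum_inner_products_le` in `L²(cell)`);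
* `tsum_setIntegral_cell_add_latticeVec` — **tiling** `Σ_{n∈ℤ³} ∫_cell f(u + Ln) du = ∫_{ℝ³} f` for integrable `f`
  (`[0,L)³` is a fundamental domain of `Lℤ³`, as in the tree's `tsum_lintegral_cell_sub_latticeVec`);
* `tsum_setIntegral_conj_cellWave_box` — the cell Fourier coefficient of the periodised box indicator:
  `Σ_n ∫_cell conj(e_p(u)) 1[u ∈ Λ_ℓ(x - Ln)] du = conj(e_p(x)) · B_p`, `B_p = ∫_{Λ_ℓ(0)} conj(e_p)`;
* `boxCoeff_zero`, `norm_boxCoeff_ge` — `B_0 = ℓ³` and `|B_p| ≥ (5/8)ℓ³` whenever `‖k‖ℓ ≤ 1`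
  (`Re e^{-ik·y} = cos(k·y) ≥ 1 - (k·y)²/2 ≥ 5/8` on the box, as `|y|² ≤ 3ℓ²/4`).
-/

noncomputable section

open MeasureTheory Filter Set WithLp Complex
open scoped ENNReal NNReal Topology ComplexConjugate BigOperators InnerProductSpace

namespace Summit.AtomisticToContinuum.BoseEinsteinCondensation.Theorems.SumRuleChainGlue

open Literature.MathematicalPhysics.QuantumManyBody.BoseGas

variable {L ℓ : ℝ}

/-! ### Bessel's inequality on the cell -/

/-- `∫_cell conj(e_p) e_q = L³ δ_{pq}` (orthogonality of the plane waves). -/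
theorem setIntegral_conj_cellWave_mul_cellWave (hL : 0 < L) (p q : Fin 3 → ℤ) :
    ∫ u in cell L, conj (cellWave L p u) * cellWave L q u = if p = q then ((L ^ 3 : ℝ) : ℂ) else 0 := by
  have h := cellFourierCoeff_cellWave hL q p
  rw [cellFourierCoeff_eq_integral hL, Complex.real_smul] at h
  have hL3 : ((L ^ 3 : ℝ) : ℂ) ≠ 0 := by exact_mod_cast (pow_pos hL 3).ne'
  have hinv : (((L ^ 3)⁻¹ : ℝ) : ℂ) = ((L ^ 3 : ℝ) : ℂ)⁻¹ := Complex.ofReal_inv _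
  rw [hinv] at h
  have := congrArg (fun z => ((L ^ 3 : ℝ) : ℂ) * z) h
  simp only [← mul_assoc, mul_inv_cancel₀ hL3, one_mul] at this
  rw [this]
  by_cases hpq : p = q
  · subst hpq; simp
  · rw [if_neg hpq, if_neg hpq, mul_zero]

/-- **Bessel's inequality on the cell.** For a bounded a.e.-strongly measurable `g` on `[0,L)³` and a finite
set of modes `S`, `Σ_{p∈S} |∫_cell conj(e_p) g|² ≤ L³ ∫_cell |g|²`. -/
theorem bessel_cell (hL : 0 < L) {g : Space → ℂ} (hgm : AEStronglyMeasurable g (volume.restrict (cell L)))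
    {C : ℝ} (hgC : ∀ u, ‖g u‖ ≤ C) (S : Finset (Fin 3 → ℤ)) :
    ∑ p ∈ S, ‖∫ u in cell L, conj (cellWave L p u) * g u‖ ^ 2 ≤ L ^ 3 * ∫ u in cell L, ‖g u‖ ^ 2 := by
  set μ : Measure Space := volume.restrict (cell L) with hμ
  have hL3 : 0 < L ^ 3 := pow_pos hL 3
  haveI : IsFiniteMeasure μ := ⟨by
    rw [hμ, Measure.restrict_apply_univ, volume_cell]; exact ENNReal.pow_lt_top ENNReal.ofReal_lt_top⟩
  set c : ℝ := (Real.sqrt (L ^ 3))⁻¹ with hc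
  have hc2 : c ^ 2 = (L ^ 3)⁻¹ := by rw [hc, inv_pow, Real.sq_sqrt hL3.le]
  have hcpos : 0 < c := by rw [hc]; positivity
  -- the normalised plane waves and `g` as elements of `L²(cell)`
  have hw : ∀ p : Fin 3 → ℤ, MemLp (fun u => (c : ℂ) * cellWave L p u) 2 μ := fun p =>
    MemLp.of_bound ((continuous_const.mul (continuous_cellWave L p)).aestronglyMeasurable) c
      (ae_of_all _ fun u => by rw [norm_mul, norm_cellWave, mul_one, Complex.norm_real, Real.norm_of_nonneg hcpos.le])
  have hg : MemLp g 2 μ := MemLp.of_bound hgm C (ae_of_all _ hgC)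
  set v : (Fin 3 → ℤ) → Lp ℂ 2 μ := fun p => (hw p).toLp _ with hv
  set x : Lp ℂ 2 μ := hg.toLp g with hx
  -- orthonormality
  have hon : Orthonormal ℂ v := by
    classical
    rw [orthonormal_iff_ite]
    intro p q
    rw [L2.inner_def]
    have hae : (fun a => ⟪(v p : Space → ℂ) a, (v q : Space → ℂ) a⟫_ℂ) =ᵐ[μ]
        fun a => (c : ℂ) ^ 2 * (conj (cellWave L p a) * cellWave L q a) := by
      filter_upwards [(hw p).coeFn_toLp, (hw q).coeFn_toLp] with a ha hb
      rw [show (v p : Space → ℂ) a = _ from ha, show (v q : Space → ℂ) a = _ from hb, RCLike.inner_apply, map_mul,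
        Complex.conj_ofReal]
      ring
    rw [integral_congr_ae hae, integral_const_mul, hμ, setIntegral_conj_cellWave_mul_cellWave hL]
    by_cases hpq : p = q
    · rw [if_pos hpq, if_pos hpq, ← Complex.ofReal_pow, ← Complex.ofReal_mul, hc2, inv_mul_cancel₀ hL3.ne',
        Complex.ofReal_one]
    · rw [if_neg hpq, if_neg hpq, mul_zero]
  -- Bessel in `L²`
  have hB := hon.sum_inner_products_le x (s := S)
  -- the coefficients
  have hcoef : ∀ p, ⟪v p, x⟫_ℂ = (c : ℂ) * ∫ u in cell L, conj (cellWave L p u) * g u := by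
    intro p
    rw [L2.inner_def]
    have hae : (fun a => ⟪(v p : Space → ℂ) a, (x : Space → ℂ) a⟫_ℂ) =ᵐ[μ]
        fun a => (c : ℂ) * (conj (cellWave L p a) * g a) := by
      filter_upwards [(hw p).coeFn_toLp, hg.coeFn_toLp] with a ha hb
      rw [show (v p : Space → ℂ) a = _ from ha, show (x : Space → ℂ) a = _ from hb, RCLike.inner_apply, map_mul,
        Complex.conj_ofReal]
      ring
    rw [integral_congr_ae hae, integral_const_mul]
  -- the norm of `g`
  have hnorm : ‖x‖ ^ 2 = ∫ u in cell L, ‖g u‖ ^ 2 := by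
    rw [@norm_sq_eq_re_inner ℂ, L2.inner_def]
    have hae : (fun a => ⟪(x : Space → ℂ) a, (x : Space → ℂ) a⟫_ℂ) =ᵐ[μ] fun a => ((‖g a‖ ^ 2 : ℝ) : ℂ) := by
      filter_upwards [hg.coeFn_toLp] with a ha
      rw [show (x : Space → ℂ) a = _ from ha, RCLike.inner_apply, Complex.mul_conj', Complex.ofReal_pow]
    rw [integral_congr_ae hae, integral_complex_ofReal, RCLike.re_to_complex, Complex.ofReal_re]
  simp only [hcoef, norm_mul, Complex.norm_real, Real.norm_of_nonneg hcpos.le, mul_pow, hc2] at hB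
  rw [hnorm, ← Finset.mul_sum] at hB
  rw [← inv_mul_le_iff₀ hL3]
  exact hB

/-! ### Tiling `ℝ³` by the translates of the cell (Bochner form) -/

/-- **Tiling** `Σ_{n∈ℤ³} ∫_{[0,L)³} f(u + Ln) du = ∫_{ℝ³} f` for an integrable `f`
(`[0,L)³` is a fundamental domain of `Lℤ³`). -/
theorem tsum_setIntegral_cell_add_latticeVec (hL : 0 < L) {f : Space → ℂ} (hf : Integrable f) :
    ∑' n : Fin 3 → ℤ, ∫ u in cell L, f (u + latticeVec L n) = ∫ u, f u := by
  let b₀ : Module.Basis (Fin 3) ℝ Space := (EuclideanSpace.basisFun (Fin 3) ℝ).toBasis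
  let b : Module.Basis (Fin 3) ℝ Space := b₀.unitsSMul fun _ => Units.mk0 L hL.ne'
  have hb : ∀ i, b i = L • EuclideanSpace.single i (1 : ℝ) := fun i => by
    simp [b, b₀, Module.Basis.unitsSMul_apply]
  have hrepr : ∀ (x : Space) (i : Fin 3), b.repr x i = L⁻¹ * x i := fun x i => by
    simp [b, b₀, Units.smul_def]
  have hfd : ZSpan.fundamentalDomain b = cell L := by
    ext x
    simp only [ZSpan.mem_fundamentalDomain, cell, Set.mem_setOf_eq, hrepr, Set.mem_Ico]
    refine forall_congr' fun i => ?_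
    rw [← div_eq_inv_mul, le_div_iff₀ hL, div_lt_iff₀ hL, zero_mul, one_mul]
  have hF := ZSpan.isAddFundamentalDomain' b (volume : Measure Space)
  haveI : Countable (Submodule.span ℤ (Set.range b)).toAddSubgroup := by
    change Countable (Submodule.span ℤ (Set.range b))
    infer_instance
  rw [hF.integral_eq_tsum'' f hf, hfd]
  let bZ := b.restrictScalars ℤ
  let e : (Fin 3 → ℤ) ≃ (Submodule.span ℤ (Set.range b)).toAddSubgroup := bZ.equivFun.symm.toEquiv
  have he : ∀ n : Fin 3 → ℤ, ((e n : Submodule.span ℤ (Set.range b)) : Space) = latticeVec L n := by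
    intro n
    simp only [e, LinearEquiv.coe_toEquiv, Module.Basis.equivFun_symm_apply, Submodule.coe_sum,
      Submodule.coe_smul_of_tower, bZ, Module.Basis.restrictScalars_apply, hb]
    ext k
    rw [latticeVec_apply, WithLp.ofLp_sum, Finset.sum_apply,
      Finset.sum_eq_single k (fun i _ hi => by simp [hi]) (by simp)]
    simp [mul_comm]
  rw [← e.tsum_eq]
  refine tsum_congr fun n => integral_congr_ae (Eventually.of_forall fun u => ?_)
  show f (u + latticeVec L n) = f ((e n : Space) + u)
  rw [add_comm, ← he n]

/-! ### The sliding box: membership symmetry, the Fourier coefficient of the periodised indicator -/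

/-- `x ∈ Λ_ℓ(u) ↔ u ∈ Λ_ℓ(x)`. -/
theorem mem_slidingBox_comm (ℓ : ℝ) (u x : Space) : x ∈ slidingBox ℓ u ↔ u ∈ slidingBox ℓ x := by
  simp only [slidingBox, Set.mem_setOf_eq, Set.mem_Icc]
  refine forall_congr' fun k => ?_
  constructor <;> rintro ⟨h1, h2⟩ <;> constructor <;> linarith

/-- `u + Ln ∈ Λ_ℓ(x) ↔ u ∈ Λ_ℓ(x - Ln)`. -/
theorem add_latticeVec_mem_slidingBox_iff (ℓ L : ℝ) (u x : Space) (n : Fin 3 → ℤ) :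
    u + latticeVec L n ∈ slidingBox ℓ x ↔ u ∈ slidingBox ℓ (x - latticeVec L n) := by
  simp only [slidingBox, Set.mem_setOf_eq, PiLp.add_apply, PiLp.sub_apply]
  refine forall_congr' fun k => ?_
  rw [show u k + latticeVec L n k - x k = u k - (x k - latticeVec L n k) by ring]

/-- **The cell Fourier coefficient of the periodised box indicator**:
`Σ_n ∫_cell conj(e_p(u)) 1[u ∈ Λ_ℓ(x - Ln)] du = conj(e_p(x)) · ∫_{Λ_ℓ(0)} conj(e_p)` (tiling of `ℝ³`, translation
covariance of box integrals of plane waves). -/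
theorem tsum_setIntegral_conj_cellWave_box (hL : 0 < L) (ℓ : ℝ) (p : Fin 3 → ℤ) (x : Space) :
    ∑' n : Fin 3 → ℤ, ∫ u in cell L, (slidingBox ℓ (x - latticeVec L n)).indicator (fun u => conj (cellWave L p u)) u =
      conj (cellWave L p x) * ∫ y in slidingBox ℓ 0, conj (cellWave L p y) := by
  set f : Space → ℂ := (slidingBox ℓ x).indicator fun u => conj (cellWave L p u) with hf
  have hfi : Integrable f := by
    rw [hf, integrable_indicator_iff (measurableSet_slidingBox ℓ x)]
    refine Measure.integrableOn_of_bounded (M := 1) ?_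
      (Complex.continuous_conj.comp (continuous_cellWave L p)).aestronglyMeasurable (Eventually.of_forall fun u => ?_)
    · rw [volume_slidingBox]; exact ENNReal.pow_ne_top ENNReal.ofReal_ne_top
    · rw [Complex.norm_conj, norm_cellWave]
  have htile := tsum_setIntegral_cell_add_latticeVec hL hfi
  have hshift : ∀ (n : Fin 3 → ℤ) (u : Space), f (u + latticeVec L n) =
      (slidingBox ℓ (x - latticeVec L n)).indicator (fun u => conj (cellWave L p u)) u := by
    intro n u
    simp only [hf, Set.indicator]
    rw [cellWave_add_latticeVec hL.ne']
    by_cases hu : u ∈ slidingBox ℓ (x - latticeVec L n)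
    · rw [if_pos ((add_latticeVec_mem_slidingBox_iff ℓ L u x n).2 hu), if_pos hu]
    · rw [if_neg (fun h => hu ((add_latticeVec_mem_slidingBox_iff ℓ L u x n).1 h)), if_neg hu]
  simp only [hshift] at htile
  rw [htile, hf, integral_indicator (measurableSet_slidingBox ℓ x), setIntegral_slidingBox_eq_zero_box,
    ← integral_const_mul]
  refine integral_congr_ae (Eventually.of_forall fun y => ?_)
  simp only [cellWave_add, map_mul]

/-! ### The box average of a plane wave -/

/-- `B_0 = ∫_{Λ_ℓ(0)} conj(e_0) = ℓ³`. -/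
theorem boxCoeff_zero (hℓ : 0 ≤ ℓ) (L : ℝ) :
    ∫ y in slidingBox ℓ 0, conj (cellWave L 0 y) = ((ℓ ^ 3 : ℝ) : ℂ) := by
  simp only [cellWave_zero, map_one]
  rw [setIntegral_const, volume_real_slidingBox hℓ, Complex.real_smul, mul_one]

/-- `|y|² ≤ 3ℓ²/4` on `Λ_ℓ(0)`. -/
theorem norm_sq_le_of_mem_slidingBox_zero {y : Space} (hy : y ∈ slidingBox ℓ 0) : ‖y‖ ^ 2 ≤ 3 * ℓ ^ 2 / 4 := by
  rw [EuclideanSpace.real_norm_sq_eq]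
  have hk : ∀ k, y k ^ 2 ≤ ℓ ^ 2 / 4 := by
    intro k
    have h := hy k
    simp only [PiLp.zero_apply, sub_zero, Set.mem_Icc] at h
    nlinarith [h.1, h.2]
  calc ∑ k : Fin 3, y k ^ 2 ≤ ∑ _k : Fin 3, ℓ ^ 2 / 4 := Finset.sum_le_sum fun k _ => hk k
    _ = 3 * ℓ ^ 2 / 4 := by simp; ring

/-- **The box average of a long plane wave is bounded below**: if `‖k‖ℓ ≤ 1` (`k = 2πp/L`), then
`|∫_{Λ_ℓ(0)} conj(e_p)| ≥ (5/8)ℓ³` (`Re conj(e_p(y)) = cos(k·y) ≥ 1 - (k·y)²/2 ≥ 5/8`). -/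
theorem norm_boxCoeff_ge (hℓ : 0 ≤ ℓ) (L : ℝ) (p : Fin 3 → ℤ)
    (hk : ‖(2 * Real.pi / L) • latticeVec 1 p‖ * ℓ ≤ 1) :
    5 / 8 * ℓ ^ 3 ≤ ‖∫ y in slidingBox ℓ 0, conj (cellWave L p y)‖ := by
  set k : Space := (2 * Real.pi / L) • latticeVec 1 p with hkdef
  have hkc : ∀ c, k c = 2 * Real.pi / L * (p c : ℝ) := fun c => by simp [hkdef, latticeVec]
  -- pointwise lower bound of the real part
  have hre : ∀ y ∈ slidingBox ℓ 0, (5 : ℝ) / 8 ≤ (conj (cellWave L p y)).re := by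
    intro y hy
    set θ : ℝ := ∑ c : Fin 3, k c * y c with hθ
    have hwave : cellWave L p y = Complex.exp (θ * Complex.I) := by
      rw [cellWave_apply]
      congr 1
      rw [hθ]
      push_cast
      rw [Finset.mul_sum, Finset.sum_div, Finset.sum_mul]
      refine Finset.sum_congr rfl fun c _ => ?_
      rw [hkc c]
      push_cast
      ring
    have hθ2 : θ ^ 2 ≤ 3 / 4 := by
      have hcs : θ ^ 2 ≤ ‖k‖ ^ 2 * ‖y‖ ^ 2 := by
        rw [hθ, EuclideanSpace.real_norm_sq_eq k, EuclideanSpace.real_norm_sq_eq y]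
        exact Finset.sum_mul_sq_le_sq_mul_sq Finset.univ (fun c => k c) (fun c => y c)
      have hy2 := norm_sq_le_of_mem_slidingBox_zero hy
      have hkl : ‖k‖ ^ 2 * ℓ ^ 2 ≤ 1 := by
        have h0 : 0 ≤ ‖k‖ * ℓ := mul_nonneg (norm_nonneg _) hℓ
        nlinarith
      calc θ ^ 2 ≤ ‖k‖ ^ 2 * ‖y‖ ^ 2 := hcs
        _ ≤ ‖k‖ ^ 2 * (3 * ℓ ^ 2 / 4) := mul_le_mul_of_nonneg_left hy2 (sq_nonneg _)
        _ = 3 / 4 * (‖k‖ ^ 2 * ℓ ^ 2) := by ring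
        _ ≤ 3 / 4 * 1 := by gcongr
        _ = 3 / 4 := by ring
    rw [hwave, ← Complex.exp_conj, map_mul, Complex.conj_ofReal, Complex.conj_I, mul_neg, ← neg_mul,
      ← Complex.ofReal_neg, Complex.exp_ofReal_mul_I_re, Real.cos_neg]
    have := Real.one_sub_sq_div_two_le_cos (x := θ)
    linarith
  -- integrate the lower bound
  have hint : IntegrableOn (fun y => conj (cellWave L p y)) (slidingBox ℓ 0) volume := by
    refine Measure.integrableOn_of_bounded (M := 1) ?_
      (Complex.continuous_conj.comp (continuous_cellWave L p)).aestronglyMeasurable (Eventually.of_forall fun u => ?_)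
    · rw [volume_slidingBox]; exact ENNReal.pow_ne_top ENNReal.ofReal_ne_top
    · rw [Complex.norm_conj, norm_cellWave]
  have hvol : volume.real (slidingBox ℓ 0) = ℓ ^ 3 := volume_real_slidingBox hℓ 0
  calc 5 / 8 * ℓ ^ 3 = ∫ _ in slidingBox ℓ 0, (5 : ℝ) / 8 := by
        rw [setIntegral_const, hvol, smul_eq_mul]; ring
    _ ≤ ∫ y in slidingBox ℓ 0, (conj (cellWave L p y)).re :=
        setIntegral_mono_on (integrableOn_const (by rw [volume_slidingBox]; exact ENNReal.pow_ne_top ENNReal.ofReal_ne_top))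
          hint.re (measurableSet_slidingBox ℓ 0) hre
    _ = (∫ y in slidingBox ℓ 0, conj (cellWave L p y)).re := by
        have := integral_re hint
        exact this
    _ ≤ ‖∫ y in slidingBox ℓ 0, conj (cellWave L p y)‖ := Complex.re_le_norm _

end Summit.AtomisticToContinuum.BoseEinsteinCondensation.Theorems.SumRuleChainGlue

end
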